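import Summits.BirchSwinnertonDyer.Rank1Residual.GaloisImage.RationalTorsionLinePlane
import Literature.NumberTheory.EllipticCurves.LocalEulerCharacteristicTorsion
import Summits.BirchSwinnertonDyer.Rank1Residual.Iwasawa.PrimeOrderLineCocycleCount
import HarnessLib

/-!
# The rational `p`-torsion line `⟨T⟩ ≤ E[p]`, II: the count `#W_T = p · #(𝓞_v ⧸ p)` at `K_v` —
# binder (iii) of the three-Lagrangian lemma as THEOREMS of the tree
# (cell `b2b-bsdres`, team n1011, seat p12 GEN 11 — TOOL file; row T-K43-COH, FILE 1b;
# skeleton `cells/n1011/skel/T-K43-COH.md`)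

HONEST FRAMING (cell `b2b-bsdres`, run/shared/lean/b2b/bsd-rank1-residual/, verbatim in every
file): the goal of the cell is to DELETE the COMBINATION-SHAPED residual classes of the
Birch–Swinnerton-Dyer formula for ALL analytic-rank `≤ 1` elliptic curves over `ℚ` — "full BSD
formula for every rank `≤ 1` curve in class `C`" assembled STRICTLY from published theorems — so
that the rank-`≤ 1` remainder becomes exactly the CONSTRUCTION-SHAPED classes, which are TYPED
(missing-input `Prop`s), NOT attempted. This is not "finishing BSD". Team n1011 (N10 / N11, the
additive block `X4 ∧ p = 3`): research route on a CONSTRUCTION-SHAPED class; no claim beyond the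
stated classes; labels UNCHANGED; nothing is booked; census output = EVIDENCE, never a Literature
fact. TOOL THEOREMS ONLY: no definition, no named fact; every cohomological input is a THEOREM of
the tree (Tate's local Euler–Poincaré characteristic `localEulerPoincareCharacteristic_holds` via
`EP.localEulerPoincareCharacteristic_adicCompletion`, local duality in bidegree `(2,0)`
`natCard_two_eq_natCard_invariants_homRep`, the long exact sequence of `ContinuousCohomologyConnecting`).

## What (r1 ROUTE-1 §43.1 (iii); p02's T-K43-TOOL F3 binder `hWc`)

Notation of FILE 1a (`RationalTorsionLinePlane`): `T ∈ E[p](K̄)` non-zero and fixed by `Γ_{K_v}`,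
`e` a Weil pairing, `g_T = P.rightHom T _ : E[p]|_{Γ_{K_v}} ⟶ μ_p|_{Γ_{K_v}}` ("pair with `T`"),
`W_T = ker H¹(g_T) ≤ H¹(K_v, E[p])`.

* `mu_eq_zero_of_forall_apply_eq` — `μ_p(F̄)^{Γ_F} = 0` when `F ∌ ζ_p` (a fixed element of `F̄`
  lies in `F`, tree `absoluteGaloisGroup.exists_algebraMap_eq_pow_of_forall_smul_eq`).
* `natCard_ker_cohomologyMap_rightHom_eq` — **`#W_T = p · #(𝓞_v ⧸ p𝓞_v)`** when `K_v` has no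
  non-trivial `p`-th root of unity (`= p²` when `#(𝓞_v/p) = p`, e.g. `K = ℚ`, `p` odd): `W_T` is
  the INJECTIVE image of `H¹(K_v, ⟨T⟩)` (exactness at `H¹(⟨T⟩)` and at `H¹(E[p])` of the long exact
  sequence of FILE 1a's `exists_isSES`, with `H⁰(K_v, μ_p) = 0`), and
  `#H¹(K_v, ⟨T⟩) = #⟨T⟩ · #H²(K_v, ⟨T⟩) · #(𝓞_v/p)` (Tate) with
  `#H²(K_v, ⟨T⟩) = #Hom_{Γ_v}(⟨T⟩, μ_p) = #μ_p(K_v) = 1`.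

Print anchors (inputs, all tree theorems): Milne, *ADT* I Cor. 2.3, Thm. 2.8; Serre, *Galois
Cohomology* I §2.2, II §5.2; r1 §43.1 (iii) "`W := ι_* H¹(ℚ₃, ⟨T⟩) ≅ Hom(G_{ℚ₃}, 𝔽₃)` is
2-dimensional (`ι_*` injective because `H⁰(ℚ₃, M/⟨T⟩) = H⁰(ℚ₃, μ₃) = 0`)" — here for any number
field and any finite place `v` with `K_v ∌ ζ_p`.
-/

noncomputable section

open scoped Classical
open CategoryTheory Function Field NumberField IsDedekindDomain WeierstrassCurve
  Literature.NumberTheory.EllipticCurves Literature.NumberTheory.GaloisRepresentations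
open Literature.NumberTheory.GaloisRepresentations.DiscreteGaloisModule (mu MuCarrier)
open scoped ContRepresentation

namespace Summit.BirchSwinnertonDyer.Rank1Residual.GaloisImage.ThreeLagrangianCoh

-- `H²` and the tree's `IsSES` need `CompactSpace Γ_F`: obtained inside the proofs by
-- `absoluteGaloisGroup_compactSpace` (no file-level instance attribute: kernel lane).


/-! ## §3 The count `#W_T = p · #(𝓞_v ⧸ p)` at `F = K_v` -/

section Count

variable {K : Type} [Field K] [NumberField K] (W : WeierstrassCurve K) [W.IsElliptic]
  (v : HeightOneSpectrum (𝓞 K)) (p : ℕ) [hp : Fact p.Prime]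
variable (e : geomTorsion W p → geomTorsion W p → AlgebraicClosure K)
  (hμ : ∀ S T, e S T ^ p = 1)
  (hadd₁ : ∀ S₁ S₂ T, e (S₁ + S₂) T = e S₁ T * e S₂ T)
  (hadd₂ : ∀ S T₁ T₂, e S (T₁ + T₂) = e S T₁ * e S T₂)
  (hgal : ∀ (σ : absoluteGaloisGroup K) (S T : geomTorsion W p), σ • e S T = e (σ • S) (σ • T))

omit hp in
/-- `μ_p(F̄)^{Γ_F} = 1` when `F` has no non-trivial `p`-th root of unity: a `Γ_F`-fixed element of
`F̄` lies in `F` (`absoluteGaloisGroup.exists_algebraMap_eq_pow_of_forall_smul_eq`, char. `0`).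
[folklore] -/
theorem mu_eq_zero_of_forall_apply_eq (F : Type) [Field F] [CharZero F]
    (hμF : ∀ ζ : F, ζ ^ p = 1 → ζ = 1) (w : MuCarrier F p)
    (hw : ∀ σ : absoluteGaloisGroup F, mu F p σ w = w) : w = 0 := by
  have hfix : ∀ σ : absoluteGaloisGroup F, σ • ((muVal F p w : (AlgebraicClosure F)ˣ) :
      AlgebraicClosure F) = muVal F p w := fun σ ↦ by
    rw [← Units.coe_smul, ← muVal_apply, hw σ]
  obtain ⟨m, y, hy⟩ :=
    absoluteGaloisGroup.exists_algebraMap_eq_pow_of_forall_smul_eq F 1 hfix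
  rw [one_pow, pow_one] at hy
  have hyp : y ^ p = 1 := by
    apply (algebraMap F (AlgebraicClosure F)).injective
    rw [map_pow, hy, map_one, ← Units.val_pow_eq_pow_val, muVal_pow_eq_one, Units.val_one]
  have h1 : (muVal F p w : AlgebraicClosure F) = 1 := by rw [← hy, hμF y hyp, map_one]
  apply muVal_injective F p
  rw [muVal_zero]
  exact Units.ext h1

/-- **`#W_T = p · #(𝓞_v ⧸ p)`** (binder `hWc` of p02's F3; `= p²` when `#(𝓞_v/p) = p`): for
`T ≠ 0` in `E[p]` fixed by `Γ_{K_v}`, `e` a Weil pairing and `K_v` without non-trivial `p`-th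
roots of unity, the kernel of `H¹(e(·,T)) : H¹(K_v, E[p]) → H¹(K_v, μ_p)` has exactly
`p · #(𝓞_v/p𝓞_v)` elements. Proof: by the long exact sequence of `exists_isSES` the kernel is the
image of `H¹(K_v, ⟨T⟩)` (`exists_map_one_eq_of_map_one_eq_zero`), injectively
(`exists_δ₀_eq_of_map_one_eq_zero` with `μ_p^{Γ_{K_v}} = 0`, `mu_eq_zero_of_forall_apply_eq`
transported along `muRestrictIso`); and `#H¹(K_v, ⟨T⟩) = #⟨T⟩ · #H²(K_v, ⟨T⟩) · #(𝓞_v/p)` by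
Tate's Euler–Poincaré characteristic (tree THEOREM `localEulerPoincareCharacteristic_holds`, through
`localEulerPoincareCharacteristic_adicCompletion`; `⟨T⟩^{Γ} = ⟨T⟩` has `p` elements) with
`#H²(K_v, ⟨T⟩) = #Hom_{Γ}(⟨T⟩, μ_p) = 1` (local duality in bidegree `(2,0)`, tree THEOREM
`natCard_two_eq_natCard_invariants_homRep`; an equivariant map from the trivial module `⟨T⟩`
lands in `μ_p^{Γ} = 0`). r1 §43.1 (iii). [cite: MilneADT2006, Ch. I §2, Thm. 2.8 and Cor. 2.3] -/
theorem natCard_ker_cohomologyMap_rightHom_eq (halt : ∀ T, e T T = 1)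
    (hnondeg : ∀ T, (∀ S, e S T = 1) → T = 0) (T : geomTorsion W p)
    (hT : ∀ σ : absoluteGaloisGroup (v.adicCompletion K), absGaloisRestrict K (v.adicCompletion K) σ • T = T)
    (hT0 : T ≠ 0) (hμF : ∀ ζ : v.adicCompletion K, ζ ^ p = 1 → ζ = 1) :
    Nat.card (cohomologyMap (((weilContPairing W p e hμ hadd₁ hadd₂ hgal).restrict
      (absGaloisRestrict K (v.adicCompletion K))).rightHom T hT) 1).hom.toLinearMap.toAddMonoidHom.ker =
      p * Nat.card (v.adicCompletionIntegers K ⧸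
        Ideal.span {((p : ℕ) : v.adicCompletionIntegers K)}) := by
  have hpp := hp.out
  let F := v.adicCompletion K
  haveI : CharZero F := charZero_adicCompletion v
  haveI := absoluteGaloisGroup_compactSpace F
  let Γ := absoluteGaloisGroup F
  obtain ⟨ρ₁, f, hses, hf, hρ₁⟩ := exists_isSES W p e hμ hadd₁ hadd₂ hgal F halt hnondeg T hT hT0
  let C : Submodule ℤ (geomTorsion W p) := (AddSubgroup.zmultiples T).toIntSubmodule
  -- (a) `H¹(f)` is injective: `μ_p|_{Γ_F}` has no invariants
  have hinv3 : ∀ w : (GaloisRep.restrictField F (mu K p)).toTopRep.ρ.invariants, w = 0 := by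
    intro w
    apply Subtype.ext
    -- transport the invariant to `μ_p(F̄)` with its honest `Γ_F`-action
    have hw : ∀ σ : Γ, mu K p (absGaloisRestrict K F σ) w.1 = w.1 := fun σ ↦ w.2 σ
    have hw' : ∀ σ : Γ, mu F p σ (muTransfer K F p w.1) = muTransfer K F p w.1 := fun σ ↦ by
      rw [← muTransfer_mu, hw σ]
    have h0 := mu_eq_zero_of_forall_apply_eq p F hμF _ hw'
    exact muTransfer_injective K F p (h0.trans (map_zero _).symm)
  have hinj : Injective (cohomologyMap f 1) := by
    refine (injective_iff_map_eq_zero' (cohomologyMap f 1).hom.toLinearMap.toAddMonoidHom).mpr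
      fun z ↦ ⟨fun hz ↦ ?_, fun hz ↦ by rw [hz]; exact map_zero _⟩
    obtain ⟨w, rfl⟩ := hses.exists_δ₀_eq_of_map_one_eq_zero z hz
    rw [hinv3 w, map_zero]
  -- (b) the kernel of `H¹(g)` is the image of `H¹(f)`
  have hrange : ∀ y, (cohomologyMap (((weilContPairing W p e hμ hadd₁ hadd₂ hgal).restrict
      (absGaloisRestrict K F)).rightHom T hT) 1 y = 0 ↔ ∃ z, cohomologyMap f 1 z = y) := by
    intro y
    refine ⟨fun hy ↦ hses.exists_map_one_eq_of_map_one_eq_zero y hy, ?_⟩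
    rintro ⟨z, rfl⟩
    obtain ⟨ψ, rfl⟩ := oneCocycleClass_surjective _ z
    rw [cohomologyMap_oneCocycleClass]
    exact cohomologyMap_rightHom_eq_zero_of_forall_mem_zmultiples W p e hμ hadd₁ hadd₂ hgal F halt T hT
      _ fun σ ↦ by rw [pullback_id_resIdHom_apply, hf]; exact (ψ.1 σ).2
  have hcard_ker : Nat.card (cohomologyMap (((weilContPairing W p e hμ hadd₁ hadd₂ hgal).restrict
      (absGaloisRestrict K F)).rightHom T hT) 1).hom.toLinearMap.toAddMonoidHom.ker =
      Nat.card (galoisCohomology ρ₁ 1) := by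
    refine (Nat.card_congr (Equiv.ofBijective (fun z ↦ ⟨cohomologyMap f 1 z, (hrange _).mpr ⟨z, rfl⟩⟩)
      ⟨fun z z' h ↦ hinj (congrArg Subtype.val h), fun y ↦ ?_⟩)).symm
    obtain ⟨z, hz⟩ := (hrange y.1).mp y.2
    exact ⟨z, Subtype.ext hz⟩
  rw [hcard_ker]
  -- (c) Tate's Euler–Poincaré characteristic for the trivial module `⟨T⟩`
  haveI : Finite C := Nat.finite_of_card_ne_zero (by
    change Nat.card (AddSubgroup.zmultiples T) ≠ 0
    rw [natCard_zmultiples_eq W p T hT0]; exact hpp.ne_zero)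
  obtain ⟨-, -, hEPC⟩ := localEulerPoincareCharacteristic_adicCompletion K v
    (EP.localEulerPoincareCharacteristic_adicCompletion K v) ρ₁
  have hCcard : Nat.card ((AddSubgroup.zmultiples T).toIntSubmodule) = p :=
    natCard_zmultiples_eq W p T hT0
  -- `#⟨T⟩^{Γ} = #⟨T⟩`
  have hinv1 : Nat.card ρ₁.toTopRep.ρ.invariants = p := by
    refine Eq.trans ?_ hCcard
    exact Nat.card_congr ⟨fun c ↦ c.1, fun c ↦ ⟨c, fun σ ↦ hρ₁ σ c⟩, fun _ ↦ rfl, fun _ ↦ rfl⟩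
  -- `#H²(K_v, ⟨T⟩) = #Hom_Γ(⟨T⟩, μ_p) = 1`
  have hM : ∀ c : C, p ^ 1 • c = 0 := fun c ↦ by
    rw [pow_one]
    apply Subtype.ext
    rw [Submodule.coe_smul_of_tower, ZeroMemClass.coe_zero]
    exact nsmul_geomTorsion_eq_zero W p (c : geomTorsion W p)
  have h2 : Nat.card (galoisCohomology ρ₁ 2) = 1 := by
    obtain ⟨-, h2⟩ := natCard_two_eq_natCard_invariants_homRep F ρ₁ hM
    change Nat.card (continuousCohomology 2 ρ₁.toTopRep) = 1
    rw [h2]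
    haveI : Subsingleton (ρ₁.homRep (mu F (p ^ 1))).toTopRep.ρ.invariants := by
      refine ⟨fun f₁ f₂ ↦ Subtype.ext (HomCarrier.ext fun c ↦ ?_)⟩
      have key : ∀ g : (ρ₁.homRep (mu F (p ^ 1))).toTopRep.ρ.invariants,
          (g.1 : HomCarrier C (MuCarrier F (p ^ 1))) c = 0 := by
        intro g
        have hμF' : ∀ ζ : F, ζ ^ (p ^ 1) = 1 → ζ = 1 := by rw [pow_one]; exact hμF
        refine mu_eq_zero_of_forall_apply_eq (p ^ 1) F hμF' _ fun σ ↦ ?_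
        have hg := (ContinuousRep.homRep_apply_eq_self_iff (ρ := ρ₁) (ω := mu F (p ^ 1)) σ g.1).mp (g.2 σ) c
        rw [hρ₁] at hg
        exact hg
      rw [key f₁, key f₂]
    exact Nat.card_of_subsingleton (0 : (ρ₁.homRep (mu F (p ^ 1))).toTopRep.ρ.invariants)
  rw [hinv1, h2, mul_one, hCcard] at hEPC
  exact hEPC.symm

end Count

end Summit.BirchSwinnertonDyer.Rank1Residual.GaloisImage.ThreeLagrangianCoh

end
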